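import Literature.NumberTheory.ModularForms.EisensteinLatticeCosetRational
import HarnessLib

/-!
# Faithfulness of `SL₂(ℤ)/±Γ(N)` on the Eisenstein series `G_4^u` of level `Γ(N)`;
# `G_3^{(1,0)} ≢ 0`

Topic `Literature/NumberTheory/ModularForms`; namespace `Literature.NumberTheory.ModularForms`.
Sequel of `EisensteinLatticeCosetRational`.  THEOREMS ONLY (no definition, no named fact).

* **`Gamma_mem_or_neg_mem_of_latticeEisenstein_vecMul_eq`** — if `G_4^{uγ} = G_4^u` for all
  `u ∈ (ℤ/Nℤ)²` then `γ ∈ ±Γ(N)` (`u = (0,1)`: the constant terms `[γ₁₀ ≡ 0] Z_4(γ₁₁) = Z_4(1) ≠ 0`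
  force `γ₁₀ ≡ 0`; `u = (1,0)`: the `q_N`-coefficients force `(γ₀₀, γ₀₁) ≡ ±(1, 0)`; the
  determinant does the rest), i.e. the finite group `SL₂(ℤ)/±Γ(N)` acts faithfully on `{G_4^u}`
  through `G_4^u ∣₄ γ = G_4^{uγ}` (Diamond–Shurman §4.2: the `G_k^v` are permuted by `SL₂(ℤ)`
  through `(ℤ/Nℤ)²`, Prop. 4.2.1, and have the expansions of Thm. 4.2.3);
* `latticeEisenstein_three_ne_zero` — `G_3^{(1,0)} ≢ 0` for `N ≥ 3` (its `q_N`-coefficient is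
  `C_3/N^3 ≠ 0`), the odd-weight multiplier used to reduce odd weights to even ones.

## References

* [DiamondShurman2005] F. Diamond, J. Shurman, *A First Course in Modular Forms*, GTM 228
  (2005), §4.2, Prop. 4.2.1, Thm. 4.2.3.
-/

noncomputable section

namespace Literature.NumberTheory.ModularForms

open scoped MatrixGroups Real CongruenceSubgroup Matrix
open UpperHalfPlane hiding I
open EisensteinSeries Complex Filter Function PowerSeries

/-! ### Faithfulness of `SL₂(ℤ)/±Γ(N)` on the `G_4^u`, and `G_3^{(1,0)} ≠ 0` -/

section Faithful

variable (N : ℕ) [NeZero N]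

omit [NeZero N] in
/-- The coefficient of `q_N` in `G_k^a`: `b₁ = (C_k/N^k) w_a(1, 1)`. [folklore] -/
theorem latticeEisensteinCoeff_one (k : ℕ) (a : Fin 2 → ZMod N) :
    latticeEisensteinCoeff N k a 1 = ((N : ℂ) ^ k)⁻¹ * ((-2 * π * Complex.I) ^ k / (k - 1).factorial) *
      latticeEisensteinWeight N k a 1 1 := by
  simp [latticeEisensteinCoeff]

/-- `e^{2πi b̃/N} = 1` forces `b = 0` in `ℤ/Nℤ`. [folklore] -/
theorem eq_zero_of_cexp_val_eq_one {b : ZMod N} (h : cexp (2 * π * Complex.I * b.val / N) = 1) : b = 0 := by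
  rw [Complex.exp_eq_one_iff] at h
  obtain ⟨m, hm⟩ := h
  have hN : (N : ℂ) ≠ 0 := by exact_mod_cast NeZero.ne N
  have hpi : (2 * π * Complex.I : ℂ) ≠ 0 := by simp [Real.pi_ne_zero, Complex.I_ne_zero]
  have hval : ((b.val : ℤ) : ℂ) = (m * N : ℤ) := by
    push_cast
    field_simp at hm
    linear_combination hm
  have hint : (b.val : ℤ) = m * N := by exact_mod_cast hval
  have hdvd : (N : ℤ) ∣ (b.val : ℤ) := ⟨m, by rw [hint, mul_comm]⟩
  have h0 : (((b.val : ℤ) : ZMod N)) = 0 := (ZMod.intCast_zmod_eq_zero_iff_dvd _ N).mpr hdvd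
  simpa using h0

/-- `e^{2πi b̃/N} + e^{-2πi b̃/N} = 2` forces `b = 0` in `ℤ/Nℤ` (`cos θ = 1`). [folklore] -/
theorem eq_zero_of_cexp_add_cexp_neg_eq_two {b : ZMod N}
    (h : cexp (2 * π * Complex.I * b.val / N) + cexp (-(2 * π * Complex.I * b.val / N)) = 2) : b = 0 := by
  have hcos : Real.cos (2 * π * b.val / N) = 1 := by
    have h2 : (2 : ℂ) * Complex.cos (2 * π * b.val / N) = 2 := by
      rw [Complex.two_cos]
      convert h using 2 <;> congr 1 <;> ring
    have h3 : Complex.cos (2 * π * b.val / N) = 1 := by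
      have := mul_left_cancel₀ (two_ne_zero) (h2.trans (mul_one (2 : ℂ)).symm)
      exact this
    have h4 : ((Real.cos (2 * π * b.val / N) : ℝ) : ℂ) = 1 := by
      rw [Complex.ofReal_cos]; push_cast; exact h3
    exact_mod_cast h4
  rw [Real.cos_eq_one_iff] at hcos
  obtain ⟨m, hm⟩ := hcos
  have hN : (N : ℝ) ≠ 0 := by exact_mod_cast NeZero.ne N
  have hval : ((b.val : ℤ) : ℝ) = (m * N : ℤ) := by
    push_cast
    field_simp at hm
    nlinarith [Real.pi_pos, hm]
  have hint : (b.val : ℤ) = m * N := by exact_mod_cast hval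
  have hdvd : (N : ℤ) ∣ (b.val : ℤ) := ⟨m, by rw [hint, mul_comm]⟩
  have h0 : (((b.val : ℤ) : ZMod N)) = 0 := (ZMod.intCast_zmod_eq_zero_iff_dvd _ N).mpr hdvd
  simpa using h0

omit [NeZero N] in
/-- The orbit map on `u = (0, 1)`: `(0,1)γ = (γ₁₀, γ₁₁)` (bottom row). [folklore] -/
theorem vecMul_zero_one (γ : SL(2, ℤ)) :
    (![0, 1] : Fin 2 → ZMod N) ᵥ* ((γ : SL(2, ZMod N)) : Matrix (Fin 2) (Fin 2) (ZMod N)) =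
      ![((γ 1 0 : ℤ) : ZMod N), ((γ 1 1 : ℤ) : ZMod N)] := by
  ext j
  fin_cases j <;> simp [Matrix.vecMul, Matrix.vecHead, Matrix.vecTail]

omit [NeZero N] in
/-- The orbit map on `u = (1, 0)`: `(1,0)γ = (γ₀₀, γ₀₁)` (top row). [folklore] -/
theorem vecMul_one_zero (γ : SL(2, ℤ)) :
    (![1, 0] : Fin 2 → ZMod N) ᵥ* ((γ : SL(2, ZMod N)) : Matrix (Fin 2) (Fin 2) (ZMod N)) =
      ![((γ 0 0 : ℤ) : ZMod N), ((γ 0 1 : ℤ) : ZMod N)] := by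
  ext j
  fin_cases j <;> simp [Matrix.vecMul, Matrix.vecHead, Matrix.vecTail]

omit [NeZero N] in
/-- The weight `w_{(A,B)}(1,1) = [A = 1] e^{2πi B̃/N} + (-1)^k [A = -1] e^{-2πi B̃/N}`. [folklore] -/
theorem latticeEisensteinWeight_one_one (k : ℕ) (a : Fin 2 → ZMod N) :
    latticeEisensteinWeight N k a 1 1 =
      (if a 0 = 1 then cexp (2 * π * Complex.I * (a 1).val / N) else 0) +
        (-1) ^ k * (if a 0 = -1 then cexp (-(2 * π * Complex.I * (a 1).val / N)) else 0) := by
  unfold latticeEisensteinWeight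
  simp only [Nat.cast_one, mul_one, eq_comm (a := (1 : ZMod N)), neg_eq_iff_eq_neg (a := a 0)]

/-- **Faithfulness of `SL₂(ℤ)/±Γ(N)` on the Eisenstein series `G_4^u`**: if `γ ∈ SL₂(ℤ)` fixes
every `G_4^u`, `u ∈ (ℤ/Nℤ)²`, under `G_4^u ↦ G_4^u ∣₄ γ = G_4^{uγ}`, then `γ ≡ ±1 (mod N)`.
(`u = (0,1)`: the constant terms `[γ₁₀ ≡ 0] Z_4(γ₁₁) = Z_4(1) ≠ 0` force `γ₁₀ ≡ 0`; `u = (1,0)`: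
the `q_N`-coefficients force `(γ₀₀, γ₀₁) ≡ ±(1, 0)`; the determinant does the rest.)  This is the
statement that the `G_4^u` separate the cosets of `±Γ(N)` in `SL₂(ℤ)` (Diamond–Shurman §4.2: the
`G_k^{v}` are permuted by `SL₂(ℤ)` through `(ℤ/Nℤ)²`). [cite: DiamondShurman2005, §4.2 (Prop. 4.2.1, Thm. 4.2.3)] -/
theorem Gamma_mem_or_neg_mem_of_latticeEisenstein_vecMul_eq (γ : SL(2, ℤ))
    (h : ∀ u : Fin 2 → ZMod N, latticeEisenstein N 4 (u ᵥ* γ) = latticeEisenstein N 4 u) :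
    γ ∈ CongruenceSubgroup.Gamma N ∨ -γ ∈ CongruenceSubgroup.Gamma N := by
  -- equality of all `q_N`-coefficients
  have hcoeff : ∀ (u : Fin 2 → ZMod N) (n : ℕ),
      latticeEisensteinCoeff N 4 (u ᵥ* γ) n = latticeEisensteinCoeff N 4 u n := by
    intro u n
    have h' : latticeEisenstein N ((4 : ℕ) : ℤ) (u ᵥ* γ) = latticeEisenstein N ((4 : ℕ) : ℤ) u := h u
    rw [← qExpansion_coeff_latticeEisensteinMF N 4 (u ᵥ* γ) (by norm_num) n,
      ← qExpansion_coeff_latticeEisensteinMF N 4 u (by norm_num) n,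
      coe_latticeEisensteinMF, coe_latticeEisensteinMF, h']
  -- Step 1: the bottom-left entry is `0 mod N`
  set A : ZMod N := ((γ 0 0 : ℤ) : ZMod N) with hA
  set B : ZMod N := ((γ 0 1 : ℤ) : ZMod N) with hB
  set C : ZMod N := ((γ 1 0 : ℤ) : ZMod N) with hC
  set D : ZMod N := ((γ 1 1 : ℤ) : ZMod N) with hD
  have hZ : cosetZeta N 4 1 ≠ 0 := cosetZeta_ne_zero_of_even N 4 (by norm_num) (by decide) 1
  have hC0 : C = 0 := by
    have h0 := hcoeff ![0, 1] 0
    rw [vecMul_zero_one] at h0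
    unfold latticeEisensteinCoeff at h0
    simp only [if_true, Matrix.cons_val_zero, Matrix.cons_val_one,
      Matrix.cons_val_fin_one] at h0
    by_contra hne
    rw [if_neg (show ¬ (((γ 1 0 : ℤ) : ZMod N)) = 0 from hne)] at h0
    exact hZ h0.symm
  -- Step 2: the top row is `±(1, 0) mod N`
  have hpi : ((N : ℂ) ^ 4)⁻¹ * ((-2 * π * Complex.I) ^ 4 / (4 - 1 : ℕ).factorial) ≠ 0 := by
    refine mul_ne_zero (inv_ne_zero (pow_ne_zero _ (by exact_mod_cast NeZero.ne N)))
      (div_ne_zero (pow_ne_zero _ neg_two_pi_I_ne_zero) (by exact_mod_cast Nat.factorial_ne_zero _))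
  have hW : latticeEisensteinWeight N 4 ![A, B] 1 1 = latticeEisensteinWeight N 4 ![1, 0] 1 1 := by
    have h1 := hcoeff ![1, 0] 1
    rw [vecMul_one_zero, latticeEisensteinCoeff_one, latticeEisensteinCoeff_one] at h1
    exact mul_left_cancel₀ hpi h1
  rw [latticeEisensteinWeight_one_one, latticeEisensteinWeight_one_one] at hW
  simp only [Matrix.cons_val_zero, Matrix.cons_val_one, Matrix.cons_val_fin_one, if_true,
    ZMod.val_zero, Nat.cast_zero, mul_zero, zero_div, neg_zero, Complex.exp_zero,
    show ((-1 : ℂ) ^ 4) = 1 by norm_num, one_mul] at hW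
  have htop : (A = 1 ∧ B = 0) ∨ (A = -1 ∧ B = 0) := by
    by_cases h2 : (1 : ZMod N) = -1
    · -- `N ∣ 2`: the two conditions coincide
      rw [if_pos h2] at hW
      by_cases hA1 : A = 1
      · have hA2 : A = -1 := hA1.trans h2
        rw [if_pos hA1, if_pos hA2] at hW
        refine Or.inl ⟨hA1, eq_zero_of_cexp_add_cexp_neg_eq_two N ?_⟩
        rw [hW]; norm_num
      · have hA2 : A ≠ -1 := fun h' ↦ hA1 (h'.trans h2.symm)
        rw [if_neg hA1, if_neg hA2] at hW
        norm_num at hW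
    · rw [if_neg h2, add_zero] at hW
      by_cases hA1 : A = 1
      · have hA2 : A ≠ -1 := fun h' ↦ h2 (hA1.symm.trans h')
        rw [if_pos hA1, if_neg hA2, add_zero] at hW
        exact Or.inl ⟨hA1, eq_zero_of_cexp_val_eq_one N hW⟩
      · by_cases hA2 : A = -1
        · rw [if_neg hA1, if_pos hA2, zero_add] at hW
          refine Or.inr ⟨hA2, eq_zero_of_cexp_val_eq_one N ?_⟩
          have := congrArg (·⁻¹) hW
          simpa [Complex.exp_neg] using this
        · rw [if_neg hA1, if_neg hA2] at hW
          norm_num at hW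
  -- Step 3: the determinant
  have hdet : A * D - B * C = 1 := by
    have := congrArg (fun x : ℤ ↦ (x : ZMod N)) (Matrix.SpecialLinearGroup.det_coe γ)
    simp only [Matrix.det_fin_two, Int.cast_sub, Int.cast_mul, Int.cast_one] at this
    exact this
  rw [hC0, mul_zero, sub_zero] at hdet
  rcases htop with ⟨hA1, hB0⟩ | ⟨hA1, hB0⟩
  · left
    rw [hA1, one_mul] at hdet
    exact CongruenceSubgroup.Gamma_mem.mpr ⟨hA1, hB0, hC0, hdet⟩
  · right
    rw [hA1, neg_one_mul] at hdet
    refine CongruenceSubgroup.Gamma_mem.mpr ⟨?_, ?_, ?_, ?_⟩ <;>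
      simp only [Matrix.SpecialLinearGroup.coe_neg, Matrix.neg_apply, Int.cast_neg]
    · rw [← hA, hA1, neg_neg]
    · rw [← hB, hB0, neg_zero]
    · rw [← hC, hC0, neg_zero]
    · rw [← hD, ← hdet]

/-- **`G_3^{(1,0)} ≢ 0` on `Γ(N)` for `N ≥ 3`**: its `q_N`-coefficient is `C_3/N^3 ≠ 0`
(`w_{(1,0)}(1,1) = 1 - [1 ≡ -1] = 1`). [cite: DiamondShurman2005, Thm. 4.2.3] -/
theorem latticeEisenstein_three_ne_zero (hN : 3 ≤ N) :
    latticeEisenstein N 3 (![1, 0] : Fin 2 → ZMod N) ≠ 0 := by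
  have h2 : (1 : ZMod N) ≠ -1 := by
    intro h
    have h2 : ((2 : ℕ) : ZMod N) = 0 := by
      rw [Nat.cast_ofNat]
      linear_combination h
    rw [ZMod.natCast_eq_zero_iff] at h2
    have := Nat.le_of_dvd two_pos h2
    omega
  intro h0
  have hc := qExpansion_coeff_latticeEisensteinMF N 3 (![1, 0] : Fin 2 → ZMod N) le_rfl 1
  rw [coe_latticeEisensteinMF,
    show latticeEisenstein N ((3 : ℕ) : ℤ) (![1, 0] : Fin 2 → ZMod N) = 0 from h0,
    qExpansion_zero, map_zero, latticeEisensteinCoeff_one, latticeEisensteinWeight_one_one] at hc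
  simp only [Matrix.cons_val_zero, Matrix.cons_val_one, Matrix.cons_val_fin_one, if_true,
    if_neg h2, ZMod.val_zero, Nat.cast_zero, mul_zero, zero_div, Complex.exp_zero, add_zero,
    mul_one] at hc
  have hC : ((N : ℂ) ^ 3)⁻¹ * ((-2 * π * Complex.I) ^ 3 / (3 - 1 : ℕ).factorial) ≠ 0 :=
    mul_ne_zero (inv_ne_zero (pow_ne_zero _ (by exact_mod_cast NeZero.ne N)))
      (div_ne_zero (pow_ne_zero _ neg_two_pi_I_ne_zero) (by exact_mod_cast Nat.factorial_ne_zero _))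
  exact hC hc.symm

end Faithful

end Literature.NumberTheory.ModularForms

end
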